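import Mathlib
import Summits.ValiantsHypothesis.ValiantsHypothesis.Theorems.MonotoneRestorationOrbitRestorationQPRowColumnMultiLevel
import HarnessLib

/-!
# Invariants of the row wreath product `Sym_n ≀ Sym_n` are orbit-restorable (ORBIT currency)

Route MonotoneRestoration, crux `OrbitRestorationQP` (stmt-ValiantsHypothesis-18293), line `depth-three-rung`, registered stub
`stub_sigmaPiSigmaValue` (A_∞).  Namespace `Summit.ValiantsHypothesis.ValiantsHypothesis.Theorems.RowColumnWreath`.  Definition-free.

The multi-statistic stratum (`Theorems/…RowColumnMultiLevel.lean`) restores the matrix-symmetric elements of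
`ℂ[g_k(row_i), g'_l(col_j)]` for arbitrary finite families of symmetric statistics.  On the row side that algebra is an INVARIANT
RING: `ℂ[g_k(row_i) : k] = ℂ[x]^{Sym_n × ⋯ × Sym_n}` (independent permutations inside every row).  This file proves the
generation statement by iterating the one-block symmetrisation of `…RowColumnStratum.lean` row by row, and obtains a stratum of A_∞
described by a SYMMETRY HYPOTHESIS ALONE (no circuit, no representation):

* `mem_adjoin_rows_aux` — if `p` is invariant under the permutations of the entries inside each row separately, then for every set
  `S` of rows `p ∈ ℂ[x_{ij} : i ∉ S; e_{k+1}(row_i) : i ∈ S]` (induction on `S`, `RowColumnStratum.mem_adjoin_esymm_of_symmetric`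
  with the block = row `i`);
* `mem_adjoin_rowEsymm_of_rowwise_symmetric` — hence `p ∈ ℂ[e_{k+1}(row_i) : i, k < n]`;
* `qpOrbitRestorable_of_rowwise_symmetric` — **THE WREATH STRATUM**: every polynomial on the `n × n` matrix that is matrix-symmetric
  and invariant under permuting the entries inside each row independently — i.e. every invariant of the wreath product
  `Sym_n ≀ Sym_n` (rows as blocks) that is also column-symmetric — is `QPOrbitRestorable 12 n`
  (`RowColumnMultiLevel.qpOrbitRestorable_multiLevel` with the statistics `e_1, …, e_n` and no column statistics).

Calibration: unconditional, VH-free; the first stratum of A_∞ cut out by invariance under a group strictly between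
`Sym_n × Sym_n` and `Sym_{n²}`; contains all polynomials in the row power sums.  Nothing here bears on VP ≠ VNP. [folklore]
[cite: DawarWilsenach2025, §3.3]

## References
* A. Dawar, G. Wilsenach, *Symmetric arithmetic circuits*, ToC 21 (2025), §3.3. [DawarWilsenach2025]
* H. Weyl, *The Classical Groups*, Princeton (1939), Chap. II §3. [Weyl1939]
-/

noncomputable section

open scoped Classical

-- `Summit.ValiantsHypothesis.ValiantsHypothesis.…` is the tree's single-conjunct layout (Sub = Summit).
set_option linter.dupNamespace false

namespace Summit.ValiantsHypothesis.ValiantsHypothesis.Theorems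

namespace RowColumnWreath

open MvPolynomial Equiv Literature.Computability.AlgebraicComplexity OrbitRestorationQPDepthThreeRung

variable {n : ℕ}

/-- **Row-by-row symmetrisation.**  If `p` is invariant under the permutations of the entries inside each row, then for every
finite set `S` of rows, `p ∈ ℂ[x_{ij} : i ∉ S; e_{k+1}(x_{i0}, …, x_{i,n-1}) : i ∈ S, k < n]`. [folklore] -/
theorem mem_adjoin_rows_aux {p : MvPolynomial (Fin n × Fin n) ℂ}
    (hrow : ∀ (i : Fin n) (τ : Perm (Fin n)),
      rename (fun q : Fin n × Fin n => if q.1 = i then (q.1, τ q.2) else q) p = p)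
    (S : Finset (Fin n)) :
    p ∈ Algebra.adjoin ℂ
      (((fun q : Fin n × Fin n => (X q : MvPolynomial (Fin n × Fin n) ℂ)) '' {q | q.1 ∉ S}) ∪
        ((fun q : Fin n × Fin n => aeval (fun j : Fin n => (X (q.1, j) : MvPolynomial (Fin n × Fin n) ℂ))
          (esymm (Fin n) ℂ ((q.2 : ℕ) + 1))) '' {q | q.1 ∈ S})) := by
  induction S using Finset.induction_on with
  | empty =>
    have htop : p ∈ Algebra.adjoin ℂ (Set.range (X : Fin n × Fin n → MvPolynomial (Fin n × Fin n) ℂ)) := by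
      rw [MvPolynomial.adjoin_range_X]
      exact Algebra.mem_top
    refine Algebra.adjoin_mono ?_ htop
    rintro _ ⟨q, rfl⟩
    exact Or.inl ⟨q, fun h => Finset.notMem_empty _ h, rfl⟩
  | @insert i S hi ih =>
    -- the hypotheses of the one-block symmetrisation with block = row `i`
    have hp' : p ∈ Algebra.adjoin ℂ
        ((((fun q : Fin n × Fin n => (X q : MvPolynomial (Fin n × Fin n) ℂ)) '' {q | q.1 ∉ insert i S}) ∪
          ((fun q : Fin n × Fin n => aeval (fun j : Fin n => (X (q.1, j) : MvPolynomial (Fin n × Fin n) ℂ))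
            (esymm (Fin n) ℂ ((q.2 : ℕ) + 1))) '' {q | q.1 ∈ S})) ∪
          Set.range (fun j : Fin n => (X (i, j) : MvPolynomial (Fin n × Fin n) ℂ))) := by
      refine Algebra.adjoin_mono ?_ ih
      rintro x (⟨q, hq, rfl⟩ | ⟨q, hq, rfl⟩)
      · by_cases hqi : q.1 = i
        · refine Or.inr ⟨q.2, ?_⟩
          change (X (i, q.2) : MvPolynomial (Fin n × Fin n) ℂ) = X q
          rw [← hqi]
        · exact Or.inl (Or.inl ⟨q, fun h => (Finset.mem_insert.1 h).elim hqi hq, rfl⟩)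
      · exact Or.inl (Or.inr ⟨q, hq, rfl⟩)
    have hρs : ∀ τ : Perm (Fin n), ∀ x ∈
        (((fun q : Fin n × Fin n => (X q : MvPolynomial (Fin n × Fin n) ℂ)) '' {q | q.1 ∉ insert i S}) ∪
          ((fun q : Fin n × Fin n => aeval (fun j : Fin n => (X (q.1, j) : MvPolynomial (Fin n × Fin n) ℂ))
            (esymm (Fin n) ℂ ((q.2 : ℕ) + 1))) '' {q | q.1 ∈ S})),
        rename (fun q : Fin n × Fin n => if q.1 = i then (q.1, τ q.2) else q) x = x := by
      rintro τ x (⟨q, hq, rfl⟩ | ⟨q, hq, rfl⟩)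
      · have hne : q.1 ≠ i := fun h => hq (h ▸ Finset.mem_insert_self i S)
        rw [rename_X, if_neg hne]
      · have hne : q.1 ≠ i := fun h => hi (h ▸ hq)
        simp only [MvPolynomial.comp_aeval_apply, rename_X, if_neg hne]
    have hρv : ∀ (τ : Perm (Fin n)) (j : Fin n),
        rename (fun q : Fin n × Fin n => if q.1 = i then (q.1, τ q.2) else q) (X (i, j) : MvPolynomial (Fin n × Fin n) ℂ) =
          X (i, τ j) := by
      intro τ j
      rw [rename_X, if_pos rfl]
    have key := RowColumnStratum.mem_adjoin_esymm_of_symmetric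
      (((fun q : Fin n × Fin n => (X q : MvPolynomial (Fin n × Fin n) ℂ)) '' {q | q.1 ∉ insert i S}) ∪
        ((fun q : Fin n × Fin n => aeval (fun j : Fin n => (X (q.1, j) : MvPolynomial (Fin n × Fin n) ℂ))
          (esymm (Fin n) ℂ ((q.2 : ℕ) + 1))) '' {q | q.1 ∈ S}))
      (fun j : Fin n => (X (i, j) : MvPolynomial (Fin n × Fin n) ℂ))
      (fun τ => rename (fun q : Fin n × Fin n => if q.1 = i then (q.1, τ q.2) else q))
      hρs hρv (fun τ => hrow i τ) hp'
    refine Algebra.adjoin_mono ?_ key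
    rintro x (hx | ⟨k, rfl⟩)
    · rcases hx with ⟨q, hq, rfl⟩ | ⟨q, hq, rfl⟩
      · exact Or.inl ⟨q, hq, rfl⟩
      · exact Or.inr ⟨q, Finset.mem_insert_of_mem hq, rfl⟩
    · exact Or.inr ⟨(i, k), Finset.mem_insert_self i S, rfl⟩

/-- **`ℂ[x]^{Sym_n^{×n}} ⊆ ℂ[e_{k+1}(row_i)]`**: a polynomial invariant under permuting the entries inside each row separately is
a polynomial in the elementary symmetric polynomials of the rows. [folklore] -/
theorem mem_adjoin_rowEsymm_of_rowwise_symmetric {p : MvPolynomial (Fin n × Fin n) ℂ}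
    (hrow : ∀ (i : Fin n) (τ : Perm (Fin n)),
      rename (fun q : Fin n × Fin n => if q.1 = i then (q.1, τ q.2) else q) p = p) :
    p ∈ Algebra.adjoin ℂ (Set.range fun q : Fin n × Fin n =>
      aeval (fun j : Fin n => (X (q.1, j) : MvPolynomial (Fin n × Fin n) ℂ)) (esymm (Fin n) ℂ ((q.2 : ℕ) + 1))) := by
  refine Algebra.adjoin_mono ?_ (mem_adjoin_rows_aux hrow Finset.univ)
  rintro x (⟨q, hq, rfl⟩ | ⟨q, -, rfl⟩)
  · exact absurd (Finset.mem_univ q.1) hq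
  · exact ⟨q, rfl⟩

/-- **THE WREATH STRATUM OF A_∞.**  A polynomial on the `n × n` matrix that is matrix-symmetric and invariant under permuting the
entries inside each row independently (an invariant of the row wreath product `Sym_n ≀ Sym_n` which is also column-symmetric) has
a square-symmetric circuit of orbit size `≤ 2^((log₂ n + 12)^12)` — no circuit hypothesis. [folklore] -/
theorem qpOrbitRestorable_of_rowwise_symmetric {p : MvPolynomial (Fin n × Fin n) ℂ}
    (hsym : ∀ σ τ : Perm (Fin n), rename (fun q : Fin n × Fin n => (σ q.1, τ q.2)) p = p)
    (hrow : ∀ (i : Fin n) (τ : Perm (Fin n)),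
      rename (fun q : Fin n × Fin n => if q.1 = i then (q.1, τ q.2) else q) p = p) :
    QPOrbitRestorable 12 n p := by
  refine RowColumnMultiLevel.qpOrbitRestorable_multiLevel (κ := Fin n) (κ' := Fin 0)
    (fun k : Fin n => esymm (Fin n) ℂ ((k : ℕ) + 1)) (fun _ : Fin 0 => (0 : MvPolynomial (Fin n) ℂ))
    (fun k => esymm_isSymmetric _ _ _) (fun l => l.elim0) hsym ?_
  refine Algebra.adjoin_mono ?_ (mem_adjoin_rowEsymm_of_rowwise_symmetric hrow)
  rintro x ⟨q, rfl⟩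
  exact Or.inl ⟨q, rfl⟩

/-- **The wreath stratum in the shape of the stub `stub_sigmaPiSigmaValue`**: a matrix-symmetric FAMILY each of whose members is
invariant under the independent within-row permutations is quasi-polynomially orbit-restorable with the absolute constant `c = 12`.
[folklore] -/
theorem restoration_of_rowwise_symmetric_family (f : (n : ℕ) → MvPolynomial (Fin n × Fin n) ℂ) (hsym : IsMatrixSymmetric f)
    (hrow : ∀ (n : ℕ) (i : Fin n) (τ : Perm (Fin n)),
      rename (fun q : Fin n × Fin n => if q.1 = i then (q.1, τ q.2) else q) (f n) = f n) :
    ∃ c : ℕ, ∀ n : ℕ, QPOrbitRestorable c n (f n) :=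
  ⟨12, fun n => qpOrbitRestorable_of_rowwise_symmetric (hsym n) (hrow n)⟩


/-! ### The wreath hypotheses alone -/

/-- Within-row symmetry for every row gives invariance under `x_{ij} ↦ x_{i, τ j}` on any set `S` of rows simultaneously.
[folklore] -/
theorem rename_rows_subset_of_rowwise_symmetric {p : MvPolynomial (Fin n × Fin n) ℂ}
    (hrow : ∀ (i : Fin n) (τ : Perm (Fin n)),
      rename (fun q : Fin n × Fin n => if q.1 = i then (q.1, τ q.2) else q) p = p)
    (τ : Perm (Fin n)) (S : Finset (Fin n)) :
    rename (fun q : Fin n × Fin n => if q.1 ∈ S then (q.1, τ q.2) else q) p = p := by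
  induction S using Finset.induction_on with
  | empty =>
    have hid : (fun q : Fin n × Fin n => if q.1 ∈ (∅ : Finset (Fin n)) then (q.1, τ q.2) else q) = id :=
      funext fun q => if_neg (Finset.notMem_empty _)
    rw [hid, rename_id, AlgHom.id_apply]
  | @insert i S hi ih =>
    have hcomp : (fun q : Fin n × Fin n => if q.1 ∈ insert i S then (q.1, τ q.2) else q) =
        (fun q : Fin n × Fin n => if q.1 = i then (q.1, τ q.2) else q) ∘
          (fun q : Fin n × Fin n => if q.1 ∈ S then (q.1, τ q.2) else q) := by
      funext q
      simp only [Function.comp_apply, Finset.mem_insert]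
      by_cases hqi : q.1 = i
      · have hqS : q.1 ∉ S := fun h => hi (hqi ▸ h)
        rw [if_pos (Or.inl hqi), if_neg hqS, if_pos hqi]
      · by_cases hqS : q.1 ∈ S
        · rw [if_pos (Or.inr hqS), if_pos hqS, if_neg hqi]
        · rw [if_neg (fun h => h.elim hqi hqS), if_neg hqS, if_neg hqi]
    rw [hcomp, ← rename_rename, ih, hrow i τ]

/-- **Wreath invariance implies matrix symmetry**: invariance under the row permutations `x_{ij} ↦ x_{σ i, j}` and under the
within-row permutations of every row gives invariance under INDEPENDENT row and column permutations. [folklore] -/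
theorem matrixSymmetric_of_wreath_invariant {p : MvPolynomial (Fin n × Fin n) ℂ}
    (hperm : ∀ σ : Perm (Fin n), rename (fun q : Fin n × Fin n => (σ q.1, q.2)) p = p)
    (hrow : ∀ (i : Fin n) (τ : Perm (Fin n)),
      rename (fun q : Fin n × Fin n => if q.1 = i then (q.1, τ q.2) else q) p = p)
    (σ τ : Perm (Fin n)) : rename (fun q : Fin n × Fin n => (σ q.1, τ q.2)) p = p := by
  have hcol : rename (fun q : Fin n × Fin n => (q.1, τ q.2)) p = p := by
    have h := rename_rows_subset_of_rowwise_symmetric hrow τ Finset.univ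
    have hfun : (fun q : Fin n × Fin n => if q.1 ∈ (Finset.univ : Finset (Fin n)) then (q.1, τ q.2) else q) =
        fun q : Fin n × Fin n => (q.1, τ q.2) := funext fun q => if_pos (Finset.mem_univ _)
    rwa [hfun] at h
  have hcomp : (fun q : Fin n × Fin n => (σ q.1, τ q.2)) =
      (fun q : Fin n × Fin n => (σ q.1, q.2)) ∘ fun q : Fin n × Fin n => (q.1, τ q.2) := funext fun q => rfl
  rw [hcomp, ← rename_rename, hcol, hperm σ]

/-- **INVARIANTS OF THE ROW WREATH PRODUCT `Sym_n ≀ Sym_n` ARE ORBIT-RESTORABLE.**  A polynomial on the `n × n` matrix invariant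
under permuting the rows and under permuting the entries inside each row independently has a square-symmetric circuit of orbit
size `≤ 2^((log₂ n + 12)^12)`. [folklore] -/
theorem qpOrbitRestorable_of_wreath_invariant {p : MvPolynomial (Fin n × Fin n) ℂ}
    (hperm : ∀ σ : Perm (Fin n), rename (fun q : Fin n × Fin n => (σ q.1, q.2)) p = p)
    (hrow : ∀ (i : Fin n) (τ : Perm (Fin n)),
      rename (fun q : Fin n × Fin n => if q.1 = i then (q.1, τ q.2) else q) p = p) :
    QPOrbitRestorable 12 n p :=
  qpOrbitRestorable_of_rowwise_symmetric (matrixSymmetric_of_wreath_invariant hperm hrow) hrow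

end RowColumnWreath

end Summit.ValiantsHypothesis.ValiantsHypothesis.Theorems

end
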